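import Mathlib
import Summits.Ventures.HodgeRepro2.LevelPositivity
import Summits.Ventures.HodgeRepro2.LevelInvariantsCount
import Summits.Ventures.HodgeRepro2.LiuOscillator
import Summits.Ventures.HodgeRepro2.T5DixmierSchur
import Summits.Ventures.HodgeRepro2.T5SchurRepresentation
import Summits.Ventures.HodgeRepro2.T5VanDantzig
import Summits.Ventures.HodgeRepro2.T5CentralCharacterLevel
import Summits.Ventures.HodgeRepro2.T6B5Data
import Summits.Ventures.HodgeRepro2.T6B5Datum
import Summits.Ventures.HodgeRepro2.T6B5Hyp
import Summits.Ventures.HodgeRepro2.T6B3Hyp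
import Summits.Ventures.HodgeRepro2.T6B5Main
import Summits.Ventures.HodgeRepro2.T6B5CentralHyp

/-!
# T6B5Central — Tier 6, sub-goal B5: Proposition B5.3(e) (the central-character constraint) over the B5 datum

TIER4 §B5 Proposition B5.3(e): «A NECESSARY condition on any level (the central-character constraint): if the
(ε, χ)-term of d(μ, K') is non-zero, then χ(z) = 1 for every scalar z ∈ K' ∩ (A_E^∞)^1 …; the K of Theorem B5.1
satisfies it for (ε_i, χ_i) automatically». In kernel, over the representation-level carriers `LiuAlbaneseDatum`
with the scalar isometries `ScalarDatum` and the displayed sentence of Liu's App. D.1 Step 3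
(`Hyp.Liu2021_AppD1_Step3`, T6B5CentralHyp.lean):

* `chi_eq_one_of_invariants_ne_bot` / `chi_eq_one_of_dimInv_pos` — Prop. B5.3(e) at ANY level: a non-zero
  `K'`-invariant vector of `ω(μ, ε, χ)` forces `χ(z) = 1` for every scalar `z` with `z ∈ K'` (the accepted generic
  lemma `LevelPositivity.central_character_eq_one` instantiated);
* `invariants_eq_bot_of_chi_ne_one` / `dimInv_eq_zero_of_chi_ne_one` — the contrapositive: a scalar `z ∈ K'` with
  `χ(z) ≠ 1` kills the `K'`-invariants, `d`'s (ε, χ)-term vanishes (why positivity can fail at a prescribed level,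
  Prop. B5.3(c) in the scalar direction);
* `B5_main_central` — `B5_main`'s conclusion together with the constraint at every level `K' ≤ K` for the four
  triples: «the K of Theorem B5.1 satisfies it for (ε_i, χ_i) automatically»;
* the SCHUR side, with the td-group properties of `G(A_F^∞)` as instance hypotheses and NO display beyond Def. 4.11:
  `central_apply_eq_self` (a central element of the level acts trivially on an irreducible admissible `ω` with
  non-zero level invariants — the accepted `T5CentralCharacterLevel.apply_eq_self_of_invariants_ne_bot_complex`),
  `schurChar` (Dixmier–Schur's central character of `ω(μ, ε, χ)`), `schurChar_eq_one_of_dimInv_pos`, and the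
  IDENTIFICATION `schurChar_scalar_eq_chi` of the printed `χ` with Schur's character on the scalars — the sentence
  T5CentralCharacterLevel.lean left as prose («the identification of the two characters»), now a theorem of the
  display; `B5_main_central_schur` = the constraint at the levels of `B5_main` in Schur's form.
Every published input is consumed BY NAME (Def. 4.11, App. D.1 Step 3, B2's index clause, t6-p6's Thm. 4.18
displays); nothing of `B5_main` / `B5_full` changes (append-only, new file, new names).
README §8(d): uses an L-value-free non-vanishing device: NO.
-/

namespace Summit.Ventures.HodgeRepro2.T6.B5Central

open Summit.Ventures.HodgeRepro2.LevelPositivity Summit.Ventures.HodgeRepro2.ShimuraData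
  Summit.Ventures.HodgeRepro2.T6.B5Data Summit.Ventures.HodgeRepro2.T6.B5Datum
  Summit.Ventures.HodgeRepro2.T6.Hyp Summit.Ventures.HodgeRepro2.T6.B5Main
  Summit.Ventures.HodgeRepro2.T5CentralCharacterLevel Summit.Ventures.HodgeRepro2.T5SchurRepresentation
  Summit.Ventures.HodgeRepro2.T5VanDantzig Summit.Ventures.HodgeRepro2.T5DixmierSchur
open Module

universe u

variable {K : Type u} [Field K] [NumberField K] [NumberField.IsCMField K] {c : Liu.IdeleConjugation K}
  {χEF : Liu.QuadraticCharacter K c} (𝓛 : LiuAlbaneseDatum K c χEF) (𝓢 : ScalarDatum 𝓛)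

section Display

/-- **Prop. B5.3(e), display form, at any level.** If `ω(μ, ε, χ)` has a non-zero vector invariant under a
subgroup `K'` of `G(A_F^∞)`, then `χ(z) = 1` for every `z ∈ (A_E^∞)^1` whose scalar isometry lies in `K'`
(the accepted generic `central_character_eq_one` with the scalar action supplied by the displayed App. D.1 Step 3). -/
theorem chi_eq_one_of_invariants_ne_bot (hD : Liu2021_AppD1_Step3 𝓛 𝓢) (t : Liu.OscillatorTriple K c χEF)
    (L' : Subgroup 𝓛.G) (hne : invariants (𝓛.ω (𝓛.osc t)) L' ≠ ⊥) (z : ↥(Liu.oneFinIdeles K c))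
    (hz : ((𝓢.scalar z : Subgroup.center 𝓛.G) : 𝓛.G) ∈ L') : t.χ.toFun z = 1 := by
  obtain ⟨w, hw, hw0⟩ := (Submodule.ne_bot_iff _).mp hne
  exact Units.val_eq_one.mp (central_character_eq_one (𝓛.ω (𝓛.osc t)) L' hz (hD t z) hw hw0)

/-- **Prop. B5.3(e), contrapositive.** A scalar `z ∈ K'` with `χ(z) ≠ 1` kills the `K'`-invariants of `ω(μ, ε, χ)`. -/
theorem invariants_eq_bot_of_chi_ne_one (hD : Liu2021_AppD1_Step3 𝓛 𝓢) (t : Liu.OscillatorTriple K c χEF)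
    (L' : Subgroup 𝓛.G) (z : ↥(Liu.oneFinIdeles K c))
    (hz : ((𝓢.scalar z : Subgroup.center 𝓛.G) : 𝓛.G) ∈ L') (hχ : t.χ.toFun z ≠ 1) :
    invariants (𝓛.ω (𝓛.osc t)) L' = ⊥ :=
  invariants_eq_bot_of_central_character_ne_one (𝓛.ω (𝓛.osc t)) L' hz (hD t z)
    (fun h => hχ (Units.val_eq_one.mp h))

/-- The `(ε, χ)`-term of `d(μ, K')` in the shape's vocabulary: `dimInv (osc t) L' = dim_ℂ ω(μ, ε, χ)^{L'}`
(definitional, recorded for the statements below). -/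
theorem dimInv_eq (h411 : Liu2021_Def4_11 𝓛) (K₀ : OpenSubgroup 𝓛.G) (t : Liu.OscillatorTriple K c χEF)
    (L : CLevel 𝓛) :
    (shape 𝓛 h411 K₀).dimInv ((shape 𝓛 h411 K₀).osc t) L =
      finrank ℂ (invariants (𝓛.ω (𝓛.osc t)) (L.1 : Subgroup 𝓛.G)) := rfl

/-- **Prop. B5.3(e) in the shape's vocabulary.** At a compact open level `L` with `d`'s `(ε, χ)`-term
`dimInv (osc t) L ≥ 1`, every scalar `z` with `z ∈ L` has `χ(z) = 1`. -/
theorem chi_eq_one_of_dimInv_pos (h411 : Liu2021_Def4_11 𝓛) (K₀ : OpenSubgroup 𝓛.G)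
    (hD : Liu2021_AppD1_Step3 𝓛 𝓢) (t : Liu.OscillatorTriple K c χEF) (L : CLevel 𝓛)
    (hpos : 0 < (shape 𝓛 h411 K₀).dimInv ((shape 𝓛 h411 K₀).osc t) L) (z : ↥(Liu.oneFinIdeles K c))
    (hz : ((𝓢.scalar z : Subgroup.center 𝓛.G) : 𝓛.G) ∈ (L.1 : Subgroup 𝓛.G)) : t.χ.toFun z = 1 := by
  refine chi_eq_one_of_invariants_ne_bot 𝓛 𝓢 hD t (L.1 : Subgroup 𝓛.G) ?_ z hz
  intro hbot
  have h0 : (shape 𝓛 h411 K₀).dimInv ((shape 𝓛 h411 K₀).osc t) L = 0 := by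
    rw [dimInv_eq, hbot]
    exact finrank_bot ℂ _
  omega

/-- **Prop. B5.3(c)/(e), the scalar direction.** At a level `L` containing a scalar `z` with `χ(z) ≠ 1` the
`(ε, χ)`-term of `d(μ, L)` vanishes: positivity is not automatic at a prescribed level. -/
theorem dimInv_eq_zero_of_chi_ne_one (h411 : Liu2021_Def4_11 𝓛) (K₀ : OpenSubgroup 𝓛.G)
    (hD : Liu2021_AppD1_Step3 𝓛 𝓢) (t : Liu.OscillatorTriple K c χEF) (L : CLevel 𝓛)
    (z : ↥(Liu.oneFinIdeles K c)) (hz : ((𝓢.scalar z : Subgroup.center 𝓛.G) : 𝓛.G) ∈ (L.1 : Subgroup 𝓛.G))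
    (hχ : t.χ.toFun z ≠ 1) : (shape 𝓛 h411 K₀).dimInv ((shape 𝓛 h411 K₀).osc t) L = 0 := by
  rw [dimInv_eq, invariants_eq_bot_of_chi_ne_one 𝓛 𝓢 hD t _ z hz hχ]
  exact finrank_bot ℂ _

/-- **TIER4 Theorem B5.1 (i), (ii), (iv) + Proposition B5.3(e).** The level `K` of `B5_main` satisfies the
central-character constraint automatically: at every compact open `K' ≤ K`, besides the index clause, positivity
`dim ω_i^{K'} ≥ 1` and `Hom_E(A_{K'}, A_{μ_i})_ℚ ≠ 0`, every scalar `z ∈ (A_E^∞)^1` with `z ∈ K'` has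
`χ_i(z) = 1` for `i = 1..4`. Inputs: the displayed Def. 4.11, the displayed App. D.1 Step 3, the index-set clause of
Prop. C.5 below `K₀` (B2), t6-p6's displays of Thm. 4.18 over the shape, B3's four admissible triples. -/
theorem B5_main_central (h411 : Liu2021_Def4_11 𝓛) (K₀ : OpenSubgroup 𝓛.G) (hK₀ : IsCompact (K₀ : Set 𝓛.G))
    (hIdx : ∀ L : OpenSubgroup 𝓛.G, IsCompact (L : Set 𝓛.G) → L ≤ K₀ → 𝓛.IsIndex L)
    (h418i : Liu2021_Thm4_18_iso (shape 𝓛 h411 K₀)) (h4181 : Liu2021_Thm4_18_1 (shape 𝓛 h411 K₀))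
    (hD : Liu2021_AppD1_Step3 𝓛 𝓢)
    (t : Fin 4 → Liu.OscillatorTriple K c χEF) (ht : ∀ i, Liu.OscillatorTriple.IsAdmissible K (t i)) :
    ∃ L : CLevel 𝓛, (shape 𝓛 h411 K₀).IsSmall L ∧ ∀ L' : CLevel 𝓛, L' ≤ L →
      𝓛.IsIndex L'.1 ∧
      (∀ i, 0 < (shape 𝓛 h411 K₀).dimInv ((shape 𝓛 h411 K₀).osc (t i)) L') ∧
      (∀ i, 0 < (shape 𝓛 h411 K₀).homDim L' (t i).μ) ∧
      (∀ i, Nontrivial (𝓛.HomQ L'.1 (t i).μ)) ∧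
      (∀ i, ∀ z : ↥(Liu.oneFinIdeles K c),
        ((𝓢.scalar z : Subgroup.center 𝓛.G) : 𝓛.G) ∈ (L'.1 : Subgroup 𝓛.G) → (t i).χ.toFun z = 1) := by
  obtain ⟨L, hL, h⟩ := B5_main 𝓛 h411 K₀ hK₀ hIdx h418i h4181 t ht
  refine ⟨L, hL, fun L' hle => ?_⟩
  obtain ⟨h1, h2, h3, h4⟩ := h L' hle
  exact ⟨h1, h2, h3, h4, fun i z hz => chi_eq_one_of_dimInv_pos 𝓛 𝓢 h411 K₀ hD (t i) L' (h2 i) z hz⟩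

end Display

section Schur

/-- Admissibility of `ω(μ, ε, χ)` in the form the Schur-side lemmas take (finite-dimensional invariants for every
open compact SUBGROUP), from the displayed Def. 4.11. -/
theorem hadm_of (h411 : Liu2021_Def4_11 𝓛) (t : Liu.OscillatorTriple K c χEF) :
    ∀ L : Subgroup 𝓛.G, IsOpen (L : Set 𝓛.G) → IsCompact (L : Set 𝓛.G) →
      FiniteDimensional ℂ (invariants (𝓛.ω (𝓛.osc t)) L) :=
  fun L hLo hLc => (h411 t).2.2 ⟨L, hLo⟩ hLc

/-- `ω(μ, ε, χ)` is a simple module over the group algebra (Mathlib's `IsIrreducible`, displayed Def. 4.11). -/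
theorem isSimpleModule_of (h411 : Liu2021_Def4_11 𝓛) (t : Liu.OscillatorTriple K c χEF) :
    IsSimpleModule (MonoidAlgebra ℂ 𝓛.G) (𝓛.ω (𝓛.osc t)).asModule :=
  (Representation.irreducible_iff_isSimpleModule_asModule _).mp (h411 t).1

variable [LocallyCompactSpace 𝓛.G] [T2Space 𝓛.G] [TotallyDisconnectedSpace 𝓛.G] [FirstCountableTopology 𝓛.G]

/-- `ω(μ, ε, χ)` has countable dimension (smooth + admissible on a first-countable td group; the accepted
`rank_le_aleph0_of_admissible`). -/
theorem rank_le_aleph0_of (h411 : Liu2021_Def4_11 𝓛) (t : Liu.OscillatorTriple K c χEF) :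
    Module.rank ℂ (𝓛.W (𝓛.osc t)) ≤ Cardinal.aleph0 :=
  rank_le_aleph0_of_admissible (𝓛.ω (𝓛.osc t)) (h411 t).2.1 (hadm_of 𝓛 h411 t)

/-- **Prop. B5.3(e) with Schur, at any level.** A CENTRAL element of `G(A_F^∞)` lying in a subgroup `K'` acts
trivially on `ω(μ, ε, χ)` as soon as `ω(μ, ε, χ)^{K'} ≠ 0` — no display beyond Def. 4.11 (the accepted
`apply_eq_self_of_invariants_ne_bot_complex`, Dixmier's Schur lemma on the countable-dimensional `ω`). -/
theorem central_apply_eq_self (h411 : Liu2021_Def4_11 𝓛) (t : Liu.OscillatorTriple K c χEF)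
    (L' : Subgroup 𝓛.G) (hne : invariants (𝓛.ω (𝓛.osc t)) L' ≠ ⊥) (z : Subgroup.center 𝓛.G)
    (hz : (z : 𝓛.G) ∈ L') (w : 𝓛.W (𝓛.osc t)) : 𝓛.ω (𝓛.osc t) z w = w := by
  haveI := isSimpleModule_of 𝓛 h411 t
  exact apply_eq_self_of_invariants_ne_bot_complex (𝓛.ω (𝓛.osc t)) (h411 t).2.1 (hadm_of 𝓛 h411 t) L' z hz hne w

/-- Schur's central character of `ω(μ, ε, χ)` (the accepted `T5SchurRepresentation.centralCharacter`, Dixmier's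
route: `ℂ` uncountable algebraically closed, `ω` irreducible of countable dimension). -/
noncomputable def schurChar (h411 : Liu2021_Def4_11 𝓛) (t : Liu.OscillatorTriple K c χEF) :
    Subgroup.center 𝓛.G →* ℂ :=
  haveI := isSimpleModule_of 𝓛 h411 t
  centralCharacter (𝓛.ω (𝓛.osc t)) aleph0_lt_mk_complex (rank_le_aleph0_of 𝓛 h411 t)

/-- Schur's character acts: `ω(μ, ε, χ)(z) w = schurChar(z) • w` for central `z`. -/
theorem schurChar_spec (h411 : Liu2021_Def4_11 𝓛) (t : Liu.OscillatorTriple K c χEF) (z : Subgroup.center 𝓛.G)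
    (w : 𝓛.W (𝓛.osc t)) : 𝓛.ω (𝓛.osc t) z w = schurChar 𝓛 h411 t z • w := by
  haveI := isSimpleModule_of 𝓛 h411 t
  exact centralCharacter_spec (𝓛.ω (𝓛.osc t)) aleph0_lt_mk_complex (rank_le_aleph0_of 𝓛 h411 t) z w

/-- **Prop. B5.3(e) with Schur, in the shape's vocabulary.** At a compact open level `L` with
`dimInv (osc t) L ≥ 1`, Schur's central character of `ω(μ, ε, χ)` is `1` on the central elements of `L`. -/
theorem schurChar_eq_one_of_dimInv_pos (h411 : Liu2021_Def4_11 𝓛) (K₀ : OpenSubgroup 𝓛.G)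
    (t : Liu.OscillatorTriple K c χEF) (L : CLevel 𝓛)
    (hpos : 0 < (shape 𝓛 h411 K₀).dimInv ((shape 𝓛 h411 K₀).osc t) L) (z : Subgroup.center 𝓛.G)
    (hz : (z : 𝓛.G) ∈ (L.1 : Subgroup 𝓛.G)) : schurChar 𝓛 h411 t z = 1 := by
  haveI := isSimpleModule_of 𝓛 h411 t
  have hne : invariants (𝓛.ω (𝓛.osc t)) (L.1 : Subgroup 𝓛.G) ≠ ⊥ := by
    intro hbot
    have h0 : (shape 𝓛 h411 K₀).dimInv ((shape 𝓛 h411 K₀).osc t) L = 0 := by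
      rw [dimInv_eq, hbot]
      exact finrank_bot ℂ _
    omega
  exact centralCharacter_eq_one_of_invariants_ne_bot (𝓛.ω (𝓛.osc t)) aleph0_lt_mk_complex
    (rank_le_aleph0_of 𝓛 h411 t) (L.1 : Subgroup 𝓛.G) z hz hne

/-- **The identification of the two characters** (the prose sentence of T5CentralCharacterLevel.lean, «the printed
χ(z) is the value of `centralCharacter`»): under the displayed App. D.1 Step 3, Schur's central character of
`ω(μ, ε, χ)` at the scalar isometry of `z ∈ (A_E^∞)^1` IS the printed `χ(z)`. -/
theorem schurChar_scalar_eq_chi (h411 : Liu2021_Def4_11 𝓛) (hD : Liu2021_AppD1_Step3 𝓛 𝓢)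
    (t : Liu.OscillatorTriple K c χEF) (z : ↥(Liu.oneFinIdeles K c)) :
    schurChar 𝓛 h411 t (𝓢.scalar z) = ((t.χ.toFun z : ℂˣ) : ℂ) := by
  haveI := nontrivial_of_isIrreducible (h411 t).1
  obtain ⟨w, hw⟩ := exists_ne (0 : 𝓛.W (𝓛.osc t))
  have h1 := schurChar_spec 𝓛 h411 t (𝓢.scalar z) w
  have h2 := hD t z w
  have h3 : schurChar 𝓛 h411 t (𝓢.scalar z) • w = ((t.χ.toFun z : ℂˣ) : ℂ) • w := h1.symm.trans h2
  exact smul_left_injective ℂ hw h3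

/-- **TIER4 Theorem B5.1 (i), (ii), (iv) + Proposition B5.3(e) in Schur's form.** At every compact open `K' ≤ K`
of `B5_main`'s level, every CENTRAL element of `G(A_F^∞)` lying in `K'` acts trivially on the four `ω_i` — with the
td-group properties of `G(A_F^∞)` as hypotheses and the displayed Def. 4.11 alone (no scalar datum, no further
display). -/
theorem B5_main_central_schur (h411 : Liu2021_Def4_11 𝓛) (K₀ : OpenSubgroup 𝓛.G)
    (hK₀ : IsCompact (K₀ : Set 𝓛.G))
    (hIdx : ∀ L : OpenSubgroup 𝓛.G, IsCompact (L : Set 𝓛.G) → L ≤ K₀ → 𝓛.IsIndex L)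
    (h418i : Liu2021_Thm4_18_iso (shape 𝓛 h411 K₀)) (h4181 : Liu2021_Thm4_18_1 (shape 𝓛 h411 K₀))
    (t : Fin 4 → Liu.OscillatorTriple K c χEF) (ht : ∀ i, Liu.OscillatorTriple.IsAdmissible K (t i)) :
    ∃ L : CLevel 𝓛, (shape 𝓛 h411 K₀).IsSmall L ∧ ∀ L' : CLevel 𝓛, L' ≤ L →
      𝓛.IsIndex L'.1 ∧
      (∀ i, 0 < (shape 𝓛 h411 K₀).dimInv ((shape 𝓛 h411 K₀).osc (t i)) L') ∧
      (∀ i, 0 < (shape 𝓛 h411 K₀).homDim L' (t i).μ) ∧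
      (∀ i, Nontrivial (𝓛.HomQ L'.1 (t i).μ)) ∧
      (∀ i, ∀ z : Subgroup.center 𝓛.G, (z : 𝓛.G) ∈ (L'.1 : Subgroup 𝓛.G) →
        ∀ w : 𝓛.W (𝓛.osc (t i)), 𝓛.ω (𝓛.osc (t i)) z w = w) := by
  obtain ⟨L, hL, h⟩ := B5_main 𝓛 h411 K₀ hK₀ hIdx h418i h4181 t ht
  refine ⟨L, hL, fun L' hle => ?_⟩
  obtain ⟨h1, h2, h3, h4⟩ := h L' hle
  refine ⟨h1, h2, h3, h4, fun i z hz w => ?_⟩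
  have hne : invariants (𝓛.ω (𝓛.osc (t i))) (L'.1 : Subgroup 𝓛.G) ≠ ⊥ := by
    intro hbot
    have h0 : (shape 𝓛 h411 K₀).dimInv ((shape 𝓛 h411 K₀).osc (t i)) L' = 0 := by
      rw [dimInv_eq, hbot]
      exact finrank_bot ℂ _
    have := h2 i
    omega
  exact central_apply_eq_self 𝓛 h411 (t i) _ hne z hz w

end Schur

end Summit.Ventures.HodgeRepro2.T6.B5Central
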